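import Summits.CriticalPhenomena.CardyFormulaZ2.Theorems.CardyBoundaryCoulombGasHalfPlaneMarkDensityLawWindowSecondMark
import Summits.CriticalPhenomena.CardyFormulaZ2.Theorems.CardyBoundaryCoulombGasHalfPlaneMarkDensityLawPosNearestLeftLower

/-!
# `HalfPlaneMarkDensityLaw` (crux stmt-CriticalPhenomena-5661), line `Sketch`, cycle 5 (near-end positivity):
# glue N3' — counting for the near-RIGHT statistic `NR`

Write `NR(k; rlo, rhi; slo)` for the event that the `H`-cluster of `(k,0)` (`H = ℤ×ℕ`) has a bottom point
in `[rlo, rhi]` and none in `[slo, k)`.  Given the deterministic inclusion N1 (on the second-mark window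
event, some `k ∈ (m₁, m₂]` satisfies `NR(k; lo, hi; ℓ)`) and translation invariance N2
(`P[NR(k; rlo+k, rhi+k; slo+k)] = P[NR(0; rlo, rhi; slo)]`), the second-mark window lower bound
`Window.stub_window2_lowerBound` at the marks `a < b+δ < b+2δ < c+3δ < y+δ/2`, `δ = (y−c)/4`, gives for
large `n`, with `k₀ = ⌊bn⌋`, `rlo₀ = ⌊cn⌋ − k₀`, `rhi₀ = ⌊yn⌋ − k₀`, `slo₀ = ⌊an⌋ − k₀`,
`m₁ = ⌊(b+δ)n⌋`, `m₂ = ⌊(b+2δ)n⌋`: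
window event `⊆ ⋃_{k ∈ (m₁,m₂]} NR(k; rlo₀+k, rhi₀+k; slo₀+k)` (N1 and monotonicity of `NR` in its three
bounds, the floor margins being `δ`, `δ/2`, `δ`), so the union bound and N2 give
`c₀ ≤ (m₂ − m₁) · P[NR(0; rlo₀, rhi₀; slo₀)] = (m₂ − m₁) · P[NR(k₀; ⌊cn⌋, ⌊yn⌋; ⌊an⌋)] ≤ 2δ n · P[NR(k₀; …)]`,
i.e. `n · P[NR(⌊bn⌋; ⌊cn⌋, ⌊yn⌋; ⌊an⌋)] ≥ c₀ / (2δ)`.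
-/

noncomputable section

namespace Summit.CriticalPhenomena.CardyFormulaZ2.Cruxes.HalfPlaneMarkDensityLaw.SketchLine

open Literature.Probability.Percolation Literature.Probability.LatticeModels
open MeasureTheory Filter Set SimpleGraph
open scoped Topology
open Summit.CriticalPhenomena.CardyFormulaZ2.Theorems.HalfPlaneMarkDensityLaw.Negative

namespace NearEndPos

/-- Eventually-in-`n` four-floor arithmetic, strict form: `p + q < r + s` gives
`⌊pn⌋ + ⌊qn⌋ < ⌊rn⌋ + ⌊sn⌋` for all large `n`. [folklore] -/
private theorem eventually_floor_add_floor_lt {p q r s : ℝ} (h : p + q < r + s) :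
    ∀ᶠ n : ℕ in atTop, ⌊p * n⌋ + ⌊q * n⌋ < ⌊r * n⌋ + ⌊s * n⌋ := by
  have hpos : 0 < r + s - p - q := by linarith
  have e1 : ∀ᶠ n : ℕ in atTop, (2 : ℝ) ≤ (r + s - p - q) * n :=
    (tendsto_natCast_atTop_atTop.const_mul_atTop hpos).eventually_ge_atTop _
  filter_upwards [e1] with n hn
  have h1 : ((⌊p * (n : ℝ)⌋ : ℤ) : ℝ) ≤ p * n := Int.floor_le _
  have h2 : ((⌊q * (n : ℝ)⌋ : ℤ) : ℝ) ≤ q * n := Int.floor_le _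
  have h3 : (r * n : ℝ) < ⌊r * (n : ℝ)⌋ + 1 := Int.lt_floor_add_one _
  have h4 : (s * n : ℝ) < ⌊s * (n : ℝ)⌋ + 1 := Int.lt_floor_add_one _
  have h5 : ((⌊p * (n : ℝ)⌋ + ⌊q * (n : ℝ)⌋ : ℤ) : ℝ) < ((⌊r * (n : ℝ)⌋ + ⌊s * (n : ℝ)⌋ : ℤ) : ℝ) := by
    push_cast; nlinarith
  exact Int.cast_lt.1 h5

/-- Abstract counting (union bound over lattice translates indexed by `(m₁, m₂]`): if `W` is covered by
events `F k`, `k ∈ (m₁, m₂]`, all of the same probability `p`, then `P[W] ≤ (m₂ − m₁) · p`. [folklore] -/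
private theorem measureReal_le_of_cover_Ioc {Ω : Type*} [MeasurableSpace Ω] (P : Measure Ω)
    [IsFiniteMeasure P] (F : ℤ → Set Ω) (W : Set Ω) {m₁ m₂ : ℤ} {p : ℝ}
    (hcover : W ⊆ ⋃ k ∈ Finset.Ioc m₁ m₂, F k) (hp : ∀ k : ℤ, P.real (F k) = p) (hm : m₁ ≤ m₂) :
    P.real W ≤ (m₂ - m₁) * p := by
  have hcardZ : ((Finset.Ioc m₁ m₂).card : ℤ) = m₂ - m₁ := Int.card_Ioc_of_le _ _ hm
  have hcard : (((Finset.Ioc m₁ m₂).card : ℤ) : ℝ) = (m₂ : ℝ) - m₁ := by exact_mod_cast hcardZ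
  calc P.real W ≤ P.real (⋃ k ∈ Finset.Ioc m₁ m₂, F k) := measureReal_mono hcover (measure_ne_top _ _)
    _ ≤ ∑ k ∈ Finset.Ioc m₁ m₂, P.real (F k) := measureReal_biUnion_finset_le _ _
    _ = ∑ k ∈ Finset.Ioc m₁ m₂, p := Finset.sum_congr rfl fun k _ => hp k
    _ = (m₂ - m₁) * p := by rw [Finset.sum_const, nsmul_eq_mul, ← hcard, Int.cast_natCast]

/-- Monotonicity of the near-right event `NR(k; rlo, rhi; slo)`: it grows when `[rlo, rhi]` grows and
`[slo, k)` shrinks. [folklore] -/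
private theorem nearRight_mono (k : ℤ) {rlo rhi slo rlo' rhi' slo' : ℤ} (h₁ : rlo' ≤ rlo) (h₂ : rhi ≤ rhi')
    (h₃ : slo ≤ slo') :
    {ω : BondConfig (Site 2) | (∃ r : ℤ, rlo ≤ r ∧ r ≤ rhi ∧ ω ∈ openConnIn halfPlane (bpt (k)) (bpt r)) ∧ ∀ s : ℤ, slo ≤ s → s < k → ω ∉ openConnIn halfPlane (bpt (k)) (bpt s)} ⊆
    {ω : BondConfig (Site 2) | (∃ r : ℤ, rlo' ≤ r ∧ r ≤ rhi' ∧ ω ∈ openConnIn halfPlane (bpt (k)) (bpt r)) ∧ ∀ s : ℤ, slo' ≤ s → s < k → ω ∉ openConnIn halfPlane (bpt (k)) (bpt s)} := by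
  rintro ω ⟨⟨r, hr₁, hr₂, hr₃⟩, hs⟩
  exact ⟨⟨r, h₁.trans hr₁, hr₂.trans h₂, hr₃⟩, fun s hs₁ hs₂ => hs s (h₃.trans hs₁) hs₂⟩

/-- STUB N3' (glue): N1, N2 and `Window.stub_window2_lowerBound` give N3 — **`n · P[NR(⌊bn⌋; ⌊cn⌋, ⌊yn⌋; ⌊an⌋)] ≥ c₀ > 0`
eventually** (`a < b < c < y`), by counting for the near-right statistic. [folklore] -/
theorem stub_nearRight_lowerBound_of :
    (∀ (ω : BondConfig (Site 2)) (ℓ m₁ m₂ lo hi : ℤ),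
      ω ∈ openCrossing halfPlane (rowIcc ℓ m₂) (rowIcc lo hi) \ openCrossing halfPlane (rowIcc ℓ m₁) (rowIcc lo hi) →
      ∃ k : ℤ, m₁ < k ∧ k ≤ m₂ ∧
        ω ∈ {ω : BondConfig (Site 2) | (∃ r : ℤ, lo ≤ r ∧ r ≤ hi ∧ ω ∈ openConnIn halfPlane (bpt (k)) (bpt r)) ∧ ∀ s : ℤ, ℓ ≤ s → s < k → ω ∉ openConnIn halfPlane (bpt (k)) (bpt s)}) →
    (∀ (k rlo rhi slo : ℤ),
      μ.real {ω : BondConfig (Site 2) | (∃ r : ℤ, rlo + k ≤ r ∧ r ≤ rhi + k ∧ ω ∈ openConnIn halfPlane (bpt (k)) (bpt r)) ∧ ∀ s : ℤ, slo + k ≤ s → s < k → ω ∉ openConnIn halfPlane (bpt (k)) (bpt s)} =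
      μ.real {ω : BondConfig (Site 2) | (∃ r : ℤ, rlo ≤ r ∧ r ≤ rhi ∧ ω ∈ openConnIn halfPlane (bpt (0)) (bpt r)) ∧ ∀ s : ℤ, slo ≤ s → s < 0 → ω ∉ openConnIn halfPlane (bpt (0)) (bpt s)}) →
    ∀ (a b c y : ℝ), a < b → b < c → c < y → ∃ c₀ : ℝ, 0 < c₀ ∧ ∀ᶠ n : ℕ in atTop,
      c₀ ≤ (n : ℝ) * μ.real {ω : BondConfig (Site 2) | (∃ r : ℤ, ⌊c * n⌋ ≤ r ∧ r ≤ ⌊y * n⌋ ∧ ω ∈ openConnIn halfPlane (bpt (⌊b * n⌋)) (bpt r)) ∧ ∀ s : ℤ, ⌊a * n⌋ ≤ s → s < ⌊b * n⌋ → ω ∉ openConnIn halfPlane (bpt (⌊b * n⌋)) (bpt s)} := by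
  intro hN1 hN2 a b c y hab hbc hcy
  -- the window marks `a < m₁' < m₂' < lo' < hi'`
  set δ : ℝ := (y - c) / 4 with hδ
  set m₁' : ℝ := b + δ with hm₁'
  set m₂' : ℝ := b + 2 * δ with hm₂'
  set lo' : ℝ := c + 3 * δ with hlo'
  set hi' : ℝ := y + δ / 2 with hhi'
  have hδ0 : 0 < δ := by rw [hδ]; linarith
  have hbm₁' : b < m₁' := by rw [hm₁']; linarith
  have ham₁' : a < m₁' := hab.trans hbm₁'
  have hm₁'m₂' : m₁' < m₂' := by rw [hm₁', hm₂']; linarith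
  have hm₂'lo' : m₂' < lo' := by rw [hm₂', hlo']; linarith
  have hlo'hi' : lo' < hi' := by rw [hlo', hhi', hδ]; linarith
  have hmargin₁ : c + m₂' < lo' + b := by rw [hm₂', hlo']; linarith
  have hmargin₂ : hi' + b < y + m₁' := by rw [hhi', hm₁']; linarith
  obtain ⟨c₀, hc₀, hW⟩ := Window.stub_window2_lowerBound a m₁' m₂' lo' hi' ham₁' hm₁'m₂' hm₂'lo' hlo'hi'
  have h2δ : 0 < 2 * δ := by positivity
  refine ⟨c₀ / (2 * δ), div_pos hc₀ h2δ, ?_⟩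
  have e5 : ∀ᶠ n : ℕ in atTop, (1 : ℝ) ≤ δ * n :=
    (tendsto_natCast_atTop_atTop.const_mul_atTop hδ0).eventually_ge_atTop _
  filter_upwards [hW, eventually_floor_add_floor_lt hmargin₁, eventually_floor_add_floor_lt hmargin₂,
    Window.eventually_floor_add_two_le hbm₁', Window.eventually_floor_add_two_le hm₁'m₂', e5]
    with n hWn e1 e2 e3 e4 e5n
  -- integer data
  set m₁ := ⌊m₁' * (n : ℝ)⌋
  set m₂ := ⌊m₂' * (n : ℝ)⌋
  set lo := ⌊lo' * (n : ℝ)⌋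
  set hi := ⌊hi' * (n : ℝ)⌋
  set k₀ := ⌊b * (n : ℝ)⌋
  set A := ⌊a * (n : ℝ)⌋
  set C := ⌊c * (n : ℝ)⌋
  set Y := ⌊y * (n : ℝ)⌋
  -- the cover of the window event by translates of `NR(0; C − k₀, Y − k₀; A − k₀)`
  have hcover : (openCrossing halfPlane (arcA a m₂' n) (rowIcc lo hi) \
      openCrossing halfPlane (arcA a m₁' n) (rowIcc lo hi)) ⊆
      ⋃ k ∈ Finset.Ioc m₁ m₂, {ω : BondConfig (Site 2) | (∃ r : ℤ, C - k₀ + k ≤ r ∧ r ≤ Y - k₀ + k ∧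
        ω ∈ openConnIn halfPlane (bpt (k)) (bpt r)) ∧ ∀ s : ℤ, A - k₀ + k ≤ s → s < k → ω ∉ openConnIn halfPlane (bpt (k)) (bpt s)} := by
    intro ω hω
    obtain ⟨k, hk₁, hk₂, hkN⟩ := hN1 ω A m₁ m₂ lo hi hω
    refine Set.mem_iUnion₂.2 ⟨k, Finset.mem_Ioc.2 ⟨hk₁, hk₂⟩, nearRight_mono k ?_ ?_ ?_ hkN⟩ <;> omega
  -- the counting bound: `P[window] ≤ (m₂ − m₁) · P[NR(0; C − k₀, Y − k₀; A − k₀)]`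
  have key : μ.real (openCrossing halfPlane (arcA a m₂' n) (rowIcc lo hi) \
      openCrossing halfPlane (arcA a m₁' n) (rowIcc lo hi)) ≤
      (m₂ - m₁) * μ.real {ω : BondConfig (Site 2) | (∃ r : ℤ, C - k₀ ≤ r ∧ r ≤ Y - k₀ ∧
        ω ∈ openConnIn halfPlane (bpt (0)) (bpt r)) ∧ ∀ s : ℤ, A - k₀ ≤ s → s < 0 → ω ∉ openConnIn halfPlane (bpt (0)) (bpt s)} :=
    measureReal_le_of_cover_Ioc μ
      (fun k => {ω : BondConfig (Site 2) | (∃ r : ℤ, C - k₀ + k ≤ r ∧ r ≤ Y - k₀ + k ∧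
        ω ∈ openConnIn halfPlane (bpt (k)) (bpt r)) ∧ ∀ s : ℤ, A - k₀ + k ≤ s → s < k → ω ∉ openConnIn halfPlane (bpt (k)) (bpt s)})
      _ hcover (fun k => hN2 k (C - k₀) (Y - k₀) (A - k₀)) (by omega)
  -- the translate at `k₀ = ⌊bn⌋` is the target event
  have hshift := hN2 k₀ (C - k₀) (Y - k₀) (A - k₀)
  simp only [sub_add_cancel] at hshift
  -- the window width `m₂ − m₁ ≤ 2δn`
  have hw : (m₂ : ℝ) - m₁ ≤ 2 * δ * n := by
    have h1 : ((m₂ : ℤ) : ℝ) ≤ m₂' * n := Int.floor_le _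
    have h2 : (m₁' * n : ℝ) < m₁ + 1 := Int.lt_floor_add_one _
    have h3 : (m₂' * n : ℝ) - m₁' * n = δ * n := by rw [hm₂', hm₁']; ring
    linarith
  have hfin := hWn.trans (key.trans (mul_le_mul_of_nonneg_right hw measureReal_nonneg))
  rw [div_le_iff₀ h2δ, hshift]
  exact hfin.trans_eq (by ring)

end NearEndPos

end Summit.CriticalPhenomena.CardyFormulaZ2.Cruxes.HalfPlaneMarkDensityLaw.SketchLine
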